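import Summits.CriticalPhenomena.PercolationContinuityZ3.Theorems.PercNearOneGluingAdditiveGluingFibreCriterion
import HarnessLib

/-!
# Crux `PercNearOneGluing.AdditiveGluing` (stmt-CriticalPhenomena-4576), line `tieline`: the fibre criterion for the Φ-transfer

Support file (`--supports stmt-CriticalPhenomena-4576`, helper, lead c15).  No named facts, no sorries; no definitions.

The registered stub `stub_phiTransfer_c14` (the Φ-transfer (Φ_D), lead c14) is, after moving everything to one side, a signed
sum of four products of three `prodBernoulli w` probabilities:
`0 ≤ μ(DN)·μ(D∩ub)·μ(D∩vb∩ouᶜ) − μ(DN)·μ(D∩vb)·μ(D∩ub∩vo) − μ(DNJ)·μ(D∩ub)·μ(D∩vb∩cuᶜ) + μ(DNJ)·μ(D∩vb)·μ(D∩ub∩vc)`,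
`D = {u ↮ v}`, `N = {c ↮ u} ∩ {c ↮ v}`, `J = {o ↔ c}`.  By c12's fibre criterion `FibreCount.cubic4_nonneg_of_fibres`
(tensor-Bernstein expansion over replica triples) it therefore follows, for EVERY weight vector, from the weight-free counting
statement (CNT_Φ): every signed fibre sum (c12's `fibreSum4` at the four cubic terms of (Φ_D)) is `≥ 0`.  (CNT_Φ) was verified by exact enumeration on random
graphs with ≤ 7 vertices and ≤ 9 edges (2.2·10⁶ fibres, 0 negative; LeadMath-c15 §5 in the crux directory, re-verifying lead
c14's (CNT_Φ) census of 5·10⁷ counts); it is the Φ-route analogue of c12's registered sub-goal `stub_fibreSumT_nonneg_c12` and,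
unlike (T_D)-type statements, the Φ-form is symmetric under `u ↔ v` (orientation-free).
[folklore] (Bernstein expansion of a multi-affine product; three-replica fibre bookkeeping as in Reimer's proof of the
van den Berg–Kesten conjecture)
-/

namespace Summit.CriticalPhenomena.PercolationContinuityZ3.Cruxes.AdditiveGluing.TieLine.FibreCount

open MeasureTheory Set Finset Literature.Probability.Percolation
open Literature.Probability.LatticeModels (prodBernoulli)

section PhiKernel

open Classical

variable {n : ℕ}

/-- **The Φ-transfer from its fibre counts.**  For fixed `(n, o, b, u, v, c)`: if every signed fibre sum of the four cubic
terms of (Φ_D) — `+ DN·(D∩ub)·(D∩vb∩ouᶜ)`, `− DN·(D∩vb)·(D∩ub∩vo)`, `− DNJ·(D∩ub)·(D∩vb∩cuᶜ)`, `+ DNJ·(D∩vb)·(D∩ub∩vc)`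
(`D = {u ↮ v}`, `N = {c ↮ u} ∩ {c ↮ v}`, `J = {o ↔ c}`), written with c12's `fibreSum4` — is nonnegative ("(CNT_Φ)"), then the
registered Φ-transfer `stub_phiTransfer_c14` holds at `(n, w, o, b, u, v, c)` for EVERY weight vector `w` (conclusion copied verbatim
from the registered signature). [folklore] -/
theorem phiTransfer_of_fibres (w : Sym2 (Fin n) → unitInterval) (o b u v c : Fin n)
    (h : ∀ I : Sym2 (Fin n) → ℕ, 0 ≤ fibreSum4 1 (-1) (-1) 1
    ((openConn u v)ᶜ ∩ ((openConn c u)ᶜ ∩ (openConn c v)ᶜ)) ((openConn u v)ᶜ ∩ openConn u b)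
      ((openConn u v)ᶜ ∩ openConn v b ∩ (openConn o u)ᶜ)
    ((openConn u v)ᶜ ∩ ((openConn c u)ᶜ ∩ (openConn c v)ᶜ)) ((openConn u v)ᶜ ∩ openConn v b)
      ((openConn u v)ᶜ ∩ openConn u b ∩ openConn v o)
    ((openConn u v)ᶜ ∩ ((openConn c u)ᶜ ∩ (openConn c v)ᶜ) ∩ openConn o c) ((openConn u v)ᶜ ∩ openConn u b)
      ((openConn u v)ᶜ ∩ openConn v b ∩ (openConn c u)ᶜ)
    ((openConn u v)ᶜ ∩ ((openConn c u)ᶜ ∩ (openConn c v)ᶜ) ∩ openConn o c) ((openConn u v)ᶜ ∩ openConn v b)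
      ((openConn u v)ᶜ ∩ openConn u b ∩ openConn v c) I) :
    (prodBernoulli w).real ((openConn u v)ᶜ ∩ ((openConn c u)ᶜ ∩ (openConn c v)ᶜ) ∩ openConn o c :
        Set (BondConfig (Fin n))) *
        ((prodBernoulli w).real ((openConn u v)ᶜ ∩ openConn u b : Set (BondConfig (Fin n))) *
            (prodBernoulli w).real ((openConn u v)ᶜ ∩ openConn v b ∩ (openConn c u)ᶜ : Set (BondConfig (Fin n))) -
          (prodBernoulli w).real ((openConn u v)ᶜ ∩ openConn v b : Set (BondConfig (Fin n))) *
            (prodBernoulli w).real ((openConn u v)ᶜ ∩ openConn u b ∩ openConn v c : Set (BondConfig (Fin n)))) ≤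
      (prodBernoulli w).real ((openConn u v)ᶜ ∩ ((openConn c u)ᶜ ∩ (openConn c v)ᶜ) : Set (BondConfig (Fin n))) *
        ((prodBernoulli w).real ((openConn u v)ᶜ ∩ openConn u b : Set (BondConfig (Fin n))) *
            (prodBernoulli w).real ((openConn u v)ᶜ ∩ openConn v b ∩ (openConn o u)ᶜ : Set (BondConfig (Fin n))) -
          (prodBernoulli w).real ((openConn u v)ᶜ ∩ openConn v b : Set (BondConfig (Fin n))) *
            (prodBernoulli w).real ((openConn u v)ᶜ ∩ openConn u b ∩ openConn v o : Set (BondConfig (Fin n)))) := by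
  have key := cubic4_nonneg_of_fibres (ι := Sym2 (Fin n)) w 1 (-1) (-1) 1
    ((openConn u v)ᶜ ∩ ((openConn c u)ᶜ ∩ (openConn c v)ᶜ)) ((openConn u v)ᶜ ∩ openConn u b)
      ((openConn u v)ᶜ ∩ openConn v b ∩ (openConn o u)ᶜ)
    ((openConn u v)ᶜ ∩ ((openConn c u)ᶜ ∩ (openConn c v)ᶜ)) ((openConn u v)ᶜ ∩ openConn v b)
      ((openConn u v)ᶜ ∩ openConn u b ∩ openConn v o)
    ((openConn u v)ᶜ ∩ ((openConn c u)ᶜ ∩ (openConn c v)ᶜ) ∩ openConn o c) ((openConn u v)ᶜ ∩ openConn u b)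
      ((openConn u v)ᶜ ∩ openConn v b ∩ (openConn c u)ᶜ)
    ((openConn u v)ᶜ ∩ ((openConn c u)ᶜ ∩ (openConn c v)ᶜ) ∩ openConn o c) ((openConn u v)ᶜ ∩ openConn v b)
      ((openConn u v)ᶜ ∩ openConn u b ∩ openConn v c) h
  nlinarith [key]

end PhiKernel

end Summit.CriticalPhenomena.PercolationContinuityZ3.Cruxes.AdditiveGluing.TieLine.FibreCount
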